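import Literature.Topology.FourManifolds.HandleExtensionDiffeo
import Literature.Topology.FourManifolds.RegularIntervalLevels
import Literature.Topology.FourManifolds.MorseDiscLevels
import HarnessLib

/-!
# The handle-extension step with the level-compatibility invariant

Topic `Literature/Topology/FourManifolds` (fact seat
`provefact-Literature.Topology.FourManifolds.IsHandlebody.exists_isBoundaryGluing_sphere`, step F2b of
the Lickorish–Wallace DAG; the induction step of the classification of handlebodies
`IsHandlebody.nonempty_diffeomorph`, abstract form).  Everything here is **proved**; no named
facts.

The induction proving that two handlebodies of the same genus are diffeomorphic carries the
invariant "the diffeomorphism preserves the levels of the presenting Morse functions near the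
boundary" (`MorseDiscLevels.lean` for the base case).  Its step: the data of a
`Literature.Topology.FourManifolds.HandlePair` on two compact manifolds with boundary whose
functions are adapted to the boundaries (`f = 1` on `∂M`, `f < 1` inside) gives, by
`HandleExtensionDiffeo.lean`, a level-shifting diffeomorphism of the sublevel sets
`{f ≤ b} ≅ {f' ≤ b + σ}` for a regular level `b` above the critical points; pushing both
manifolds into these sublevel sets **with a common profile** (`RegularIntervalLevels.lean`,
`exists_diffeomorph_sublevel_apply_eq`) and composing yields a diffeomorphism `M ≅ M'` which
**preserves the levels near the boundary** (`HandlePair.exists_diffeomorph_apply_eq`) — the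
same bookkeeping as in the base case `IsMorseAdapted.exists_diffeomorph_apply_eq_of_unique_isMCriticalPt`.

## References

* J. Milnor, *Lectures on the h-cobordism theorem* (1965), Thm. 3.13. [MilnorHCobordism1965]
* J. Milnor, *Morse theory* (1963), Thm. 3.1. [Milnor1963]
* A. Kosinski, *Differential Manifolds* (1993), VI (11.4)(c), VII §2. [Kosinski1993]
-/

open scoped Manifold ContDiff Topology
open Set Function Filter Metric

noncomputable section

namespace Literature.Topology.FourManifolds

universe u

namespace HandlePair

variable {n : ℕ} {M : Type u} [TopologicalSpace M] [T2Space M] [CompactSpace M]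
  [ChartedSpace (EuclideanHalfSpace (n + 1)) M] [IsManifold (𝓡∂ (n + 1)) ∞ M]
  {M' : Type u} [TopologicalSpace M'] [T2Space M'] [CompactSpace M']
  [ChartedSpace (EuclideanHalfSpace (n + 1)) M'] [IsManifold (𝓡∂ (n + 1)) ∞ M']
  (P : HandlePair (𝓡∂ (n + 1)) M M')

/-- **The handle-extension step, level-compatible form.**  Let `P` be the data of the
handle-extension step on two compact manifolds with boundary of dimension `n + 1 ≥ 2` whose
functions `f`, `f'` are adapted to the boundaries (`= 1` on the boundary, `< 1` inside), and
let `b` be a level with `a + η ≤ b ≤ ℓ⁺ - 2δ`, `b < 1`, `b + σ < 1`, such that `f` (resp. `f'`)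
has no critical point at or above `b` (resp. `b + σ`).  Then there are a diffeomorphism
`Ψ : M ≅ M'` and `s₁ > 0` with `f' (Ψ x) = f x` whenever `1 - f x < s₁`: both manifolds are
pushed into `{f ≤ b}`, `{f' ≤ b + σ}` with a common profile (`exists_diffeomorph_sublevel_apply_eq`)
and these are compared by the handle-extension diffeomorphism (`diffeomorphSublevel`), which
shifts the levels near the top by `σ`.  Milnor 1965, Thm. 3.13 with Milnor 1963, Thm. 3.1;
Kosinski 1993, VI (11.4)(c). [cite: MilnorHCobordism1965, Thm. 3.13] [cite: Milnor1963, Thm. 3.1] -/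
theorem exists_diffeomorph_apply_eq (hn : 1 ≤ n)
    (hbd : ∀ x ∈ (𝓡∂ (n + 1)).boundary M, P.S.f x = 1) (hlt : ∀ x ∈ (𝓡∂ (n + 1)).interior M, P.S.f x < 1)
    (hbd' : ∀ x ∈ (𝓡∂ (n + 1)).boundary M', P.S'.f x = 1) (hlt' : ∀ x ∈ (𝓡∂ (n + 1)).interior M', P.S'.f x < 1)
    {b : ℝ} (hb₁ : P.S.a + P.S.η ≤ b) (hb₂ : b ≤ P.S.ℓu - 2 * P.S.δ) (hb1 : b < 1) (hb1' : b + P.σ < 1)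
    (hregb : ∀ x, b ≤ P.S.f x → mfderiv (𝓡∂ (n + 1)) 𝓘(ℝ, ℝ) P.S.f x ≠ 0)
    (hregb' : ∀ x, b + P.σ ≤ P.S'.f x → mfderiv (𝓡∂ (n + 1)) 𝓘(ℝ, ℝ) P.S'.f x ≠ 0) :
    ∃ (Ψ : M ≃ₘ⟮𝓡∂ (n + 1), 𝓡∂ (n + 1)⟯ M') (s₁ : ℝ), 0 < s₁ ∧
      ∀ x, 1 - P.S.f x < s₁ → P.S'.f (Ψ x) = P.S.f x := by
  -- the sublevel-set structures
  have hint : ∀ p, P.S.f p ≤ b → (𝓡∂ (n + 1)).IsInteriorPoint p := fun p hp =>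
    ((𝓡∂ (n + 1)).isInteriorPoint_or_isBoundaryPoint p).resolve_right fun hb => by
      have := hbd p hb; linarith
  have hreg' : ∀ p, P.S.f p = b → ¬ IsMCriticalPt (𝓡∂ (n + 1)) P.S.f p := fun p hp hc =>
    hregb p hp.ge hc
  have hintM' : ∀ p, P.S'.f p ≤ b + P.σ → (𝓡∂ (n + 1)).IsInteriorPoint p := fun p hp =>
    ((𝓡∂ (n + 1)).isInteriorPoint_or_isBoundaryPoint p).resolve_right fun hb => by
      have := hbd' p hb; linarith
  have hregM' : ∀ p, P.S'.f p = b + P.σ → ¬ IsMCriticalPt (𝓡∂ (n + 1)) P.S'.f p := fun p hp hc =>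
    hregb' p hp.ge hc
  letI csb := (sublevelAtlas P.S.hf b hint hreg').chartedSpace
  letI csb' := (sublevelAtlas P.S'.hf (b + P.σ) hintM' hregM').chartedSpace
  -- the handle-extension diffeomorphism of the sublevel sets
  set Φ := P.diffeomorphSublevel hn hb₁ hb₂ hint hreg' hintM' hregM' with hΦ
  -- common height for the two pushes
  obtain ⟨amax, hamax, ha⟩ := exists_diffeomorph_sublevel_apply_eq hn P.S.hf hbd hlt hb1 hregb hint hreg'
  obtain ⟨amax', hamax', ha'⟩ := exists_diffeomorph_sublevel_apply_eq hn P.S'.hf hbd' hlt' hb1' hregb' hintM' hregM'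
  set a₀ := min amax amax' with ha₀def
  have ha₀pos : 0 < a₀ := lt_min hamax hamax'
  obtain ⟨G, s₀, hs₀, hG⟩ := ha a₀ ha₀pos (min_le_left _ _)
  obtain ⟨G', s₀', hs₀', hG'⟩ := ha' a₀ ha₀pos (min_le_right _ _)
  set Ψ : M ≃ₘ⟮𝓡∂ (n + 1), 𝓡∂ (n + 1)⟯ M' := G.trans (Φ.trans G'.symm) with hΨ
  -- `Ψ` maps a thin collar of `∂M` into `{1 - f' < s₀'}`
  set U' : Set M' := {x' | 1 - P.S'.f x' < s₀'} with hU'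
  have hU'o : IsOpen U' := isOpen_lt (continuous_const.sub P.S'.hf.continuous) continuous_const
  have hUo : IsOpen (Ψ ⁻¹' U') := hU'o.preimage Ψ.continuous
  have hbdΨ : Ψ ⁻¹' (𝓡∂ (n + 1)).boundary M' = (𝓡∂ (n + 1)).boundary M :=
    Ψ.preimage_boundary (by simp)
  have h1 : ∀ x, x ∉ Ψ ⁻¹' U' → P.S.f x < 1 := by
    intro x hx
    refine hlt x (((𝓡∂ (n + 1)).isInteriorPoint_or_isBoundaryPoint x).resolve_right fun hb => ?_)
    have hb' : x ∈ Ψ ⁻¹' (𝓡∂ (n + 1)).boundary M' := by rw [hbdΨ]; exact hb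
    have h1' : P.S'.f (Ψ x) = 1 := hbd' _ hb'
    exact hx (show 1 - P.S'.f (Ψ x) < s₀' by rw [h1', sub_self]; exact hs₀')
  obtain ⟨s₂, hs₂, hcollar⟩ := exists_pos_forall_sub_lt_mem P.S.hf.continuous hUo h1
  -- the collar on which the level of `G x` is above `a - η/2`
  set s₃ : ℝ := b - P.S.a with hs₃
  have hs₃pos : 0 < s₃ := by rw [hs₃]; linarith [P.S.η_pos]
  refine ⟨Ψ, min (min s₀ s₂) s₃, lt_min (lt_min hs₀ hs₂) hs₃pos, fun x hx => ?_⟩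
  have hx₀ : 1 - P.S.f x < s₀ := lt_of_lt_of_le hx ((min_le_left _ _).trans (min_le_left _ _))
  have hx₂ : 1 - P.S.f x < s₂ := lt_of_lt_of_le hx ((min_le_left _ _).trans (min_le_right _ _))
  have hx₃ : 1 - P.S.f x < s₃ := lt_of_lt_of_le hx (min_le_right _ _)
  have hxU : Ψ x ∈ U' := hcollar x hx₂
  -- the level of `G x`, above `a - η/2`
  have hGx := hG x hx₀
  have hκ := pushDepthOf_pos ha₀pos
  have hσle := pushShiftOf_le ha₀pos (1 - P.S.f x)
  have hlev : P.S.a - P.S.η / 2 < P.S.f (G x).1 := by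
    rw [hGx]; linarith [P.S.η_pos]
  -- the level shift through the handle
  have hΦx : P.S'.f (Φ (G x)).1 = P.S.f (G x).1 + P.σ :=
    P.apply_diffeomorphSublevel hn hb₁ hb₂ hint hreg' hintM' hregM' (G x) hlev
  -- the level formula of `G'` at `Ψ x`
  have hGx' : G' (Ψ x) = Φ (G x) := by
    rw [hΨ, Diffeomorph.coe_trans, Diffeomorph.coe_trans, comp_apply, comp_apply, Diffeomorph.apply_symm_apply]
  have h := hG' (Ψ x) hxU
  rw [hGx', hΦx, hGx] at h
  have hσeq : pushShiftOf a₀ (1 - P.S'.f (Ψ x)) = pushShiftOf a₀ (1 - P.S.f x) := by linarith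
  have := (strictMono_pushShiftOf ha₀pos).injective hσeq
  linarith

end HandlePair

end Literature.Topology.FourManifolds
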